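import Summits.CriticalPhenomena.CardyFormulaZ2.Theorems.CardyWickAnisotropyBoxFamilyToCardyTightness
import HarnessLib

/-!
# Split glue for crux `BoxFamilyToCardy` (stmt-CriticalPhenomena-14215, route `CardyWickAnisotropy`)

Crux-strategist seat `cstrat-stmt-CriticalPhenomena-14215-s1`, output (b) DECOMPOSITION. The crux
`BoxFamilyToCardy : AnisotropicBoxCardy → CardyFormulaZ2` is, modulo the printed DKKMO 2020 Thm. 2.1
(`DKKMO2020_thm21_schrammSmirnov`), equivalent to `AnisotropicBoxCardy → ConfInvTransport`
(`Birth.boxFamilyToCardy_iff_confInvTransport`, landed). This file lands the assembly theorem of the typed split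
`BoxFamilyToCardy ⇐ (AnisotropicBoxCardy → RectCardy) ∧ ConfInvTransport` — child 1 the KNOWN half (closed modulo the
printed fact by `Birth.isotropicRectangles_of_thm21SS`), child 2 = stmt-CriticalPhenomena-0794 verbatim (the open
half, shared with route `CardyMonotoneApproach`) — for
`ledger route edit route-CriticalPhenomena-CardyWickAnisotropy --split BoxFamilyToCardy --into children-I.json --glue-by
Summit.CriticalPhenomena.CardyFormulaZ2.Cruxes.BoxFamilyToCardy.Split.BoxFamilyToCardy_of_subs_verbatim`
(prepared in `Cruxes/BoxFamilyToCardy/STRATEGY-CENSUS.md`, § Decomposition). Nothing here is new mathematics: the seam is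
lead c5's `cardyFormulaZ2_of_confInvTransport_of_rectCardy` (realise the cross-ratio as a rectangle modulus, transport).
[folklore]
-/

namespace Summit.CriticalPhenomena.CardyFormulaZ2.Cruxes.BoxFamilyToCardy.Split

open Summit.CriticalPhenomena.CardyFormulaZ2.Theses.CardyWickAnisotropy (AnisotropicBoxCardy BoxFamilyToCardy)
open Summit.CriticalPhenomena.CardyFormulaZ2.Theses.CardyMonotoneApproach (RectCardy ConfInvTransport)
open Summit.CriticalPhenomena.CardyFormulaZ2.Cruxes.BoxFamilyToCardy.Birth (cardyFormulaZ2_of_confInvTransport_of_rectCardy)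

/-- **Split glue, by name — `(AnisotropicBoxCardy → RectCardy) → ConfInvTransport → BoxFamilyToCardy`.** Given
`AnisotropicBoxCardy`, child 1 gives Cardy's values on corner-marked axis-parallel rectangles of bond-`ℤ²`; any
cross-ratio is a rectangle modulus, and `ConfInvTransport` (stmt-0794) carries the limit to every conformal rectangle
(`cardyFormulaZ2_of_confInvTransport_of_rectCardy`). [folklore] -/
theorem BoxFamilyToCardy_of_subs :
    (AnisotropicBoxCardy → RectCardy) → ConfInvTransport → BoxFamilyToCardy :=
  fun h1 h2 hA => cardyFormulaZ2_of_confInvTransport_of_rectCardy h2 (h1 hA)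

/-- **The same glue with both children's statements inlined verbatim** (child 1 = `AnisotropicBoxCardy →` the body of
`RectCardy`, stmt-5843; child 2 = the body of `ConfInvTransport`, stmt-0794) — the literal type
`C₁ → C₂ → BoxFamilyToCardy` that `route edit --split … --glue-by` matches against `children-I.json`. [folklore] -/
theorem BoxFamilyToCardy_of_subs_verbatim :
    (AnisotropicBoxCardy → (∀ (R : Literature.Probability.RandomPlanarGeometry.ConformalRectangle) (w h : ℝ), 0 < w → 0 < h → R.carrier = Set.Ioo (0:ℝ) w ×ℂ Set.Ioo (0:ℝ) h → (R.pt 0 = (h:ℂ) * Complex.I ∧ R.pt 1 = 0 ∧ R.pt 2 = (w:ℂ) ∧ R.pt 3 = (w:ℂ) + (h:ℂ) * Complex.I) → R.HasCrossingLimit (Literature.Probability.Percolation.bondDomainCrossingProb R) Literature.Probability.RandomPlanarGeometry.cardyFunction)) →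
    (∀ (R R' : Literature.Probability.RandomPlanarGeometry.ConformalRectangle) (φ : Literature.Probability.RandomPlanarGeometry.ConformalEquiv UpperHalfPlane.upperHalfPlaneSet R.carrier) (x : Fin 4 → ℝ) (φ' : Literature.Probability.RandomPlanarGeometry.ConformalEquiv UpperHalfPlane.upperHalfPlaneSet R'.carrier) (x' : Fin 4 → ℝ), R.IsUniformizing φ x → R'.IsUniformizing φ' x' → Literature.Probability.RandomPlanarGeometry.crossRatio x = Literature.Probability.RandomPlanarGeometry.crossRatio x' → ∀ L : ℝ, Filter.Tendsto (Literature.Probability.Percolation.bondDomainCrossingProb R) (nhdsWithin 0 (Set.Ioi 0)) (nhds L) → Filter.Tendsto (Literature.Probability.Percolation.bondDomainCrossingProb R') (nhdsWithin 0 (Set.Ioi 0)) (nhds L)) →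
    BoxFamilyToCardy :=
  BoxFamilyToCardy_of_subs

end Summit.CriticalPhenomena.CardyFormulaZ2.Cruxes.BoxFamilyToCardy.Split
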